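import Mathlib
import Summits.KontsevichZagierPeriods.Zeta5Search.Families.DualConstantTermInstances
import Summits.KontsevichZagierPeriods.Zeta5Search.Families.DualConstantTermBinomialCoeff
import Summits.KontsevichZagierPeriods.Zeta5Search.Families.DualExactFullCone
import Summits.KontsevichZagierPeriods.Zeta5Search.QWedgeCFQBasic
import HarnessLib

/-!
# ζ(5) search — Families: D-exact in BINOMIAL form is a theorem (`LeadingCoeffIsDualCTBinom` discharged)

HONEST FRAMING: systematic search; no irrationality claim unless certified.  Exact identities between integers
(seat P2 g8, Families layer); nothing about the arithmetic of ζ(5); no number of record moves.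

`Families/DualConstantTermInstances` (P2 g6) typed the node `LeadingCoeffIsDualCTBinom`
(`|Q(a)| = dualCTBinom a` for `bzNum a, bzDen a ≥ 0`), the BINOMIAL form of CONJECTURE D-exact: Brown–Zudilin's
leading coefficient `Q(a)` of [BrownZudilin2022, (17)] (a double binomial sum) equals an explicit terminating 4-fold
binomial sum.  D-exact itself — `|Q(a)| = dualConstantTerm a`, the constant term of the integrand on the dual cell as
an `MvPolynomial` coefficient — is cert-2 g8's theorem `DualR.leadingCoeffIsDualConstantTerm_holds`
(`Families/DualExactFullCone`).  What was missing in the kernel is the bookkeeping identity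
`dualCTBinom a = dualConstantTerm a`, i.e. the coefficient extraction in the order `g₅, g₀, g₄, g₁, g₃`
(`Families/DualConstantTermBinomialCoeff`: `DualCTB.dualSpanProd_eq_sum4`, `DualCTB.coeff_term`) followed by the
identification of ranges and guards carried out here:
* `DualCTB.zsummand`, `DualCTB.termCoeff_mul_eq_zsummand` — per-term identification with the `zchoose` summand of
  `dualCTBinom` (thirteen guards; the last one is the homogeneity `Σ_e A_e = Σ_w B_w`);
* **`DualCTB.coeff_dualSpanProd_eq_binom`** — `[g^B] dualSpanProd A =` the 4-fold `zchoose` sum (ranges `j ≤ B₅`,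
  `i ≤ B₀`, `l ≤ A₁`, `r ≤ A₆`) for every `A : Fin 8 → ℕ`, `B : Fin 6 → ℕ` with `A₀+A₁+A₂+A₃+A₆+A₇ = B₀+⋯+B₅`;
* `bzNum_sum_eq_bzDen_sum` (that homogeneity is automatic for Brown–Zudilin exponents),
  **`dualCTBinom_eq_dualConstantTerm`** (for `bzNum a, bzDen a ≥ 0`), and
  **`leadingCoeffIsDualCTBinom_holds : LeadingCoeffIsDualCTBinom`**.
Standard axioms only.
-/

noncomputable section

open MvPolynomial Finset

namespace Summit.KontsevichZagierPeriods.Zeta5Search.Families.Cellular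

open Literature.NumberTheory.Irrationality
open Literature.NumberTheory.Irrationality.BrownZudilin2022 (zchoose)

namespace DualCTB

open DualCT

/-! ### STEP 3 — identification with the `zchoose` summand of `dualCTBinom` -/

/-- `zchoose n k = C(n,k)` on natural numbers, with NO side condition (both sides vanish for `k > n`).  (The vanishing
lemmas `CFQ.zchoose_neg` / `CFQ.zchoose_lt` of `QWedgeCFQBasic` are reused below, not restated.) -/
theorem zchoose_natCast_eq (n k : ℕ) : zchoose (n : ℤ) (k : ℤ) = (n.choose k : ℤ) := by
  unfold zchoose
  by_cases h : k ≤ n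
  · rw [if_pos ⟨by positivity, by exact_mod_cast h⟩]
    simp
  · rw [if_neg (fun h' => h (by exact_mod_cast h'.2)), Nat.choose_eq_zero_of_lt (not_le.mp h)]
    simp

/-- The `zchoose` summand of `dualCTBinom` written for natural-number data `A, B` (indices `j, i, l, r`). -/
def zsummand (A : Fin 8 → ℕ) (B : Fin 6 → ℕ) (j i l r : ℕ) : ℤ :=
  zchoose (A 1) j * zchoose (A 2) ((B 5 : ℤ) - j) * (zchoose (A 6) i * zchoose (A 7) ((B 0 : ℤ) - i)) *
    (zchoose ((A 1 : ℤ) - j) l * zchoose ((A 2 : ℤ) + A 3 - B 5 + j + l) (B 4)) *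
    (zchoose ((A 6 : ℤ) - i) r * zchoose ((A 0 : ℤ) + A 7 - B 0 + i + r) ((B 1 : ℤ) - A 1 + j + l) *
      zchoose ((A 2 : ℤ) + A 3 - B 5 + j + l - B 4) ((B 3 : ℤ) - A 6 + i + r))

/-- STEP 3 (per term): under homogeneity, `C(A₁,j)C(A₆,i)C(A₁−j,l)C(A₆−i,r) · termCoeff = zsummand`. -/
theorem termCoeff_mul_eq_zsummand (A : Fin 8 → ℕ) (B : Fin 6 → ℕ)
    (hh : A 0 + A 1 + A 2 + A 3 + A 6 + A 7 = B 0 + B 1 + B 2 + B 3 + B 4 + B 5) (j i l r : ℕ) :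
    ((A 1).choose j : ℤ) * (A 6).choose i * (((A 1 - j).choose l : ℤ) * (A 6 - i).choose r) *
      termCoeff A B j i l r = zsummand A B j i l r := by
  unfold termCoeff zsummand
  by_cases g1 : j ≤ A 1
  swap
  · rw [Nat.choose_eq_zero_of_lt (by omega : A 1 < j),
      CFQ.zchoose_lt (N := (A 1 : ℤ)) (K := (j : ℤ)) (by exact_mod_cast (by omega : A 1 < j))]
    simp
  by_cases g2 : j ≤ B 5
  swap
  · rw [if_neg g2, CFQ.zchoose_neg (N := (A 2 : ℤ)) (by omega)]
    simp
  rw [if_pos g2]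
  by_cases g3 : B 5 - j ≤ A 2
  swap
  · rw [Nat.choose_eq_zero_of_lt (by omega : A 2 < B 5 - j),
      CFQ.zchoose_lt (N := (A 2 : ℤ)) (K := (B 5 : ℤ) - j) (by omega)]
    simp
  by_cases g4 : i ≤ A 6
  swap
  · rw [Nat.choose_eq_zero_of_lt (by omega : A 6 < i),
      CFQ.zchoose_lt (N := (A 6 : ℤ)) (K := (i : ℤ)) (by exact_mod_cast (by omega : A 6 < i))]
    simp
  by_cases g5 : i ≤ B 0
  swap
  · rw [if_neg g5, CFQ.zchoose_neg (N := (A 7 : ℤ)) (by omega)]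
    simp
  rw [if_pos g5]
  by_cases g6 : B 0 - i ≤ A 7
  swap
  · rw [Nat.choose_eq_zero_of_lt (by omega : A 7 < B 0 - i),
      CFQ.zchoose_lt (N := (A 7 : ℤ)) (K := (B 0 : ℤ) - i) (by omega)]
    simp
  by_cases g7 : l ≤ A 1 - j
  swap
  · rw [Nat.choose_eq_zero_of_lt (by omega : A 1 - j < l),
      CFQ.zchoose_lt (N := (A 1 : ℤ) - j) (K := (l : ℤ)) (by omega)]
    simp
  by_cases g8 : B 4 ≤ l + A 3 + (A 2 - (B 5 - j))
  swap
  · rw [Nat.choose_eq_zero_of_lt (by omega : l + A 3 + (A 2 - (B 5 - j)) < B 4),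
      CFQ.zchoose_lt (N := (A 2 : ℤ) + A 3 - B 5 + j + l) (K := (B 4 : ℤ)) (by omega)]
    simp
  by_cases g9 : r ≤ A 6 - i
  swap
  · rw [Nat.choose_eq_zero_of_lt (by omega : A 6 - i < r),
      CFQ.zchoose_lt (N := (A 6 : ℤ) - i) (K := (r : ℤ)) (by omega)]
    simp
  by_cases g10 : A 1 - j - l ≤ B 1
  swap
  · rw [if_neg g10, CFQ.zchoose_neg (N := (A 0 : ℤ) + A 7 - B 0 + i + r) (by omega)]
    simp
  rw [if_pos g10]
  by_cases g11 : B 1 - (A 1 - j - l) ≤ r + A 0 + (A 7 - (B 0 - i))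
  swap
  · rw [Nat.choose_eq_zero_of_lt (by omega : r + A 0 + (A 7 - (B 0 - i)) < B 1 - (A 1 - j - l)),
      CFQ.zchoose_lt (N := (A 0 : ℤ) + A 7 - B 0 + i + r) (K := (B 1 : ℤ) - A 1 + j + l) (by omega)]
    simp
  by_cases g12 : A 6 - i - r ≤ B 3
  swap
  · rw [if_neg g12, CFQ.zchoose_neg (N := (A 2 : ℤ) + A 3 - B 5 + j + l - B 4) (by omega)]
    simp
  rw [if_pos g12]
  by_cases g13 : B 3 - (A 6 - i - r) ≤ l + A 3 + (A 2 - (B 5 - j)) - B 4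
  swap
  · rw [Nat.choose_eq_zero_of_lt (by omega : l + A 3 + (A 2 - (B 5 - j)) - B 4 < B 3 - (A 6 - i - r)),
      CFQ.zchoose_lt (N := (A 2 : ℤ) + A 3 - B 5 + j + l - B 4) (K := (B 3 : ℤ) - A 6 + i + r) (by omega)]
    simp
  have hE : l + A 3 + (A 2 - (B 5 - j)) - B 4 - (B 3 - (A 6 - i - r)) +
      (r + A 0 + (A 7 - (B 0 - i)) - (B 1 - (A 1 - j - l))) = B 2 := by omega
  rw [if_pos hE]
  -- all guards hold: every `zchoose` argument is the cast of the corresponding natural number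
  have e1 : ((B 5 : ℤ) - j) = ((B 5 - j : ℕ) : ℤ) := by omega
  have e2 : ((B 0 : ℤ) - i) = ((B 0 - i : ℕ) : ℤ) := by omega
  have e3 : ((A 1 : ℤ) - j) = ((A 1 - j : ℕ) : ℤ) := by omega
  have e4 : ((A 2 : ℤ) + A 3 - B 5 + j + l) = ((l + A 3 + (A 2 - (B 5 - j)) : ℕ) : ℤ) := by omega
  have e5 : ((A 6 : ℤ) - i) = ((A 6 - i : ℕ) : ℤ) := by omega
  have e6 : ((A 0 : ℤ) + A 7 - B 0 + i + r) = ((r + A 0 + (A 7 - (B 0 - i)) : ℕ) : ℤ) := by omega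
  have e7 : ((B 1 : ℤ) - A 1 + j + l) = ((B 1 - (A 1 - j - l) : ℕ) : ℤ) := by omega
  have e8 : ((A 2 : ℤ) + A 3 - B 5 + j + l - B 4) = ((l + A 3 + (A 2 - (B 5 - j)) - B 4 : ℕ) : ℤ) := by omega
  have e9 : ((B 3 : ℤ) - A 6 + i + r) = ((B 3 - (A 6 - i - r) : ℕ) : ℤ) := by omega
  rw [e8, e4, e1, e2, e3, e5, e6, e7, e9]
  simp only [zchoose_natCast_eq]
  ring

/-! ### STEP 4 — assembling: the coefficient as the 4-fold `zchoose` sum -/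

/-- A finite sum over `range (M+1)` equals the sum over `range (N+1)` when the summand vanishes beyond both. -/
theorem sum_range_succ_eq_of_vanish (f : ℕ → ℤ) {M N K : ℕ} (hM : K ≤ M) (hN : K ≤ N)
    (h : ∀ k, K < k → f k = 0) :
    ∑ k ∈ range (M + 1), f k = ∑ k ∈ range (N + 1), f k := by
  have key : ∀ L, K ≤ L → ∑ k ∈ range (L + 1), f k = ∑ k ∈ range (K + 1), f k := by
    intro L hL
    refine (Finset.sum_subset (fun x hx => Finset.mem_range.mpr
      (lt_of_lt_of_le (Finset.mem_range.mp hx) (Nat.succ_le_succ hL))) ?_).symm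
    intro k hk hk'
    rw [Finset.mem_range] at hk hk'
    exact h k (by omega)
  rw [key M hM, key N hN]

/-- **`[g^B] dualSpanProd A` as the 4-fold `zchoose` sum** (ranges `j ≤ B₅`, `i ≤ B₀`, `l ≤ A₁`, `r ≤ A₆`), for all
natural exponent data with the homogeneity `A₀+A₁+A₂+A₃+A₆+A₇ = B₀+⋯+B₅`. -/
theorem coeff_dualSpanProd_eq_binom (A : Fin 8 → ℕ) (B : Fin 6 → ℕ)
    (hh : A 0 + A 1 + A 2 + A 3 + A 6 + A 7 = B 0 + B 1 + B 2 + B 3 + B 4 + B 5) :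
    coeff (Finsupp.equivFunOnFinite.symm B) (dualSpanProd A) =
      ∑ j ∈ range (B 5 + 1), ∑ i ∈ range (B 0 + 1), ∑ l ∈ range (A 1 + 1), ∑ r ∈ range (A 6 + 1),
        zsummand A B j i l r := by
  rw [dualSpanProd_eq_sum4]
  simp only [coeff_sum, coeff_C_mul, coeff_term, Finsupp.coe_equivFunOnFinite_symm,
    termCoeff_mul_eq_zsummand A B hh]
  -- the four summation ranges: every discrepancy is killed by a vanishing `zchoose`
  have vj : ∀ j, A 1 < j → ∀ i l r, zsummand A B j i l r = 0 := by
    intro j hj i l r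
    unfold zsummand
    rw [CFQ.zchoose_lt (N := (A 1 : ℤ)) (K := (j : ℤ)) (by exact_mod_cast hj)]
    simp
  have vj' : ∀ j, B 5 < j → ∀ i l r, zsummand A B j i l r = 0 := by
    intro j hj i l r
    unfold zsummand
    rw [CFQ.zchoose_neg (N := (A 2 : ℤ)) (K := (B 5 : ℤ) - j) (by omega)]
    simp
  have vi : ∀ i, A 6 < i → ∀ j l r, zsummand A B j i l r = 0 := by
    intro i hi j l r
    unfold zsummand
    rw [CFQ.zchoose_lt (N := (A 6 : ℤ)) (K := (i : ℤ)) (by exact_mod_cast hi)]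
    simp
  have vi' : ∀ i, B 0 < i → ∀ j l r, zsummand A B j i l r = 0 := by
    intro i hi j l r
    unfold zsummand
    rw [CFQ.zchoose_neg (N := (A 7 : ℤ)) (K := (B 0 : ℤ) - i) (by omega)]
    simp
  have vl : ∀ j l, A 1 - j < l → ∀ i r, zsummand A B j i l r = 0 := by
    intro j l hl i r
    unfold zsummand
    by_cases hj : j ≤ A 1
    · rw [CFQ.zchoose_lt (N := (A 1 : ℤ) - j) (K := (l : ℤ)) (by omega)]
      simp
    · rw [CFQ.zchoose_lt (N := (A 1 : ℤ)) (K := (j : ℤ)) (by omega)]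
      simp
  have vr : ∀ i r, A 6 - i < r → ∀ j l, zsummand A B j i l r = 0 := by
    intro i r hr j l
    unfold zsummand
    by_cases hi : i ≤ A 6
    · rw [CFQ.zchoose_lt (N := (A 6 : ℤ) - i) (K := (r : ℤ)) (by omega)]
      simp
    · rw [CFQ.zchoose_lt (N := (A 6 : ℤ)) (K := (i : ℤ)) (by omega)]
      simp
  have hr' : ∀ j i l, ∑ r ∈ range (A 6 - i + 1), zsummand A B j i l r =
      ∑ r ∈ range (A 6 + 1), zsummand A B j i l r := fun j i l =>
    sum_range_succ_eq_of_vanish (fun r => zsummand A B j i l r) le_rfl (Nat.sub_le _ _)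
      (fun r hr => vr i r hr j l)
  have hl' : ∀ j i, ∑ l ∈ range (A 1 - j + 1), ∑ r ∈ range (A 6 + 1), zsummand A B j i l r =
      ∑ l ∈ range (A 1 + 1), ∑ r ∈ range (A 6 + 1), zsummand A B j i l r := fun j i =>
    sum_range_succ_eq_of_vanish (fun l => ∑ r ∈ range (A 6 + 1), zsummand A B j i l r) le_rfl
      (Nat.sub_le _ _) (fun l hl => Finset.sum_eq_zero fun r _ => vl j l hl i r)
  have hi' : ∀ j, ∑ i ∈ range (A 6 + 1), ∑ l ∈ range (A 1 + 1), ∑ r ∈ range (A 6 + 1), zsummand A B j i l r =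
      ∑ i ∈ range (B 0 + 1), ∑ l ∈ range (A 1 + 1), ∑ r ∈ range (A 6 + 1), zsummand A B j i l r := fun j =>
    sum_range_succ_eq_of_vanish (fun i => ∑ l ∈ range (A 1 + 1), ∑ r ∈ range (A 6 + 1), zsummand A B j i l r)
      (min_le_left (A 6) (B 0)) (min_le_right (A 6) (B 0))
      (fun i hi => Finset.sum_eq_zero fun l _ => Finset.sum_eq_zero fun r _ => by
        rcases min_lt_iff.mp hi with h' | h'
        · exact vi i h' j l r
        · exact vi' i h' j l r)
  simp only [hr', hl', hi']
  exact sum_range_succ_eq_of_vanish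
    (fun j => ∑ i ∈ range (B 0 + 1), ∑ l ∈ range (A 1 + 1), ∑ r ∈ range (A 6 + 1), zsummand A B j i l r)
    (min_le_left (A 1) (B 5)) (min_le_right (A 1) (B 5))
    (fun j hj => Finset.sum_eq_zero fun i _ => Finset.sum_eq_zero fun l _ => Finset.sum_eq_zero fun r _ => by
      rcases min_lt_iff.mp hj with h' | h'
      · exact vj j h' i l r
      · exact vj' j h' i l r)

end DualCTB

/-! ### The theorems -/

/-- Homogeneity of the Brown–Zudilin exponents on the dual cell: `Σ_{finite edges} A_e = Σ_{finite gaps} B_w`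
(`A = bzNum a` at positions `0,1,2,3,6,7`; `B = bzDen a` at `0,…,5`), for every `a ∈ ℤ⁸`. -/
theorem bzNum_sum_eq_bzDen_sum (a : Fin 8 → ℤ) :
    bzNum a 0 + bzNum a 1 + bzNum a 2 + bzNum a 3 + bzNum a 6 + bzNum a 7 =
      bzDen a 0 + bzDen a 1 + bzDen a 2 + bzDen a 3 + bzDen a 4 + bzDen a 5 := by
  simp [bzNum, bzDen, BrownZudilin2022.b24, BrownZudilin2022.b14, BrownZudilin2022.b57,
    BrownZudilin2022.b35]
  ring

/-- **The binomial form equals the constant term**: `dualCTBinom a = dualConstantTerm a` whenever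
`bzNum a ≥ 0` and `bzDen a ≥ 0` (the bookkeeping of one coefficient extraction, now in the kernel). -/
theorem dualCTBinom_eq_dualConstantTerm (a : Fin 8 → ℤ) (hA : ∀ i, 0 ≤ bzNum a i) (hB : ∀ i, 0 ≤ bzDen a i) :
    dualCTBinom a = dualConstantTerm a := by
  have hAc : ∀ i, (((bzNum a i).toNat : ℕ) : ℤ) = bzNum a i := fun i => Int.toNat_of_nonneg (hA i)
  have hBc : ∀ i, (((bzDen a i).toNat : ℕ) : ℤ) = bzDen a i := fun i => Int.toNat_of_nonneg (hB i)
  have hh : (bzNum a 0).toNat + (bzNum a 1).toNat + (bzNum a 2).toNat + (bzNum a 3).toNat +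
      (bzNum a 6).toNat + (bzNum a 7).toNat =
      (bzDen a 0).toNat + (bzDen a 1).toNat + (bzDen a 2).toNat + (bzDen a 3).toNat +
      (bzDen a 4).toNat + (bzDen a 5).toNat := by
    have := bzNum_sum_eq_bzDen_sum a
    zify
    rw [hAc, hAc, hAc, hAc, hAc, hAc, hBc, hBc, hBc, hBc, hBc, hBc]
    exact this
  have key := DualCTB.coeff_dualSpanProd_eq_binom (fun i => (bzNum a i).toNat)
    (fun w : Fin 6 => (bzDen a (Fin.castLE (by norm_num) w)).toNat) hh
  unfold dualConstantTerm
  rw [key]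
  unfold dualCTBinom DualCTB.zsummand
  simp only [hAc, hBc]
  rfl

/-- **CONJECTURE D-exact in binomial form is a THEOREM**: for every `a ∈ ℤ⁸` with `bzNum a ≥ 0`, `bzDen a ≥ 0`,
`|Q(a)| = dualCTBinom a` — Brown–Zudilin's double sum (17) equals the explicit terminating 4-fold binomial sum
(discharges the `@[conjecture]` node `LeadingCoeffIsDualCTBinom` of `Families/DualConstantTermInstances`; inputs:
cert-2 g8's D-exact `DualR.leadingCoeffIsDualConstantTerm_holds` and `dualCTBinom_eq_dualConstantTerm`). -/
theorem leadingCoeffIsDualCTBinom_holds : LeadingCoeffIsDualCTBinom := by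
  intro a hA hB
  rw [dualCTBinom_eq_dualConstantTerm a hA hB]
  exact DualR.leadingCoeffIsDualConstantTerm_holds a hA hB

end Summit.KontsevichZagierPeriods.Zeta5Search.Families.Cellular
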